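import Literature.AlgebraicGeometry.HodgeTheory.WeilClassesDescendingProofs
import Literature.AlgebraicGeometry.HodgeTheory.WeilClassesProducts
import Literature.AlgebraicGeometry.HodgeTheory.HodgeTypeExteriorProduct
import Literature.AlgebraicGeometry.HodgeTheory.HodgeTypeConjugation
import Literature.AlgebraicGeometry.HodgeTheory.ComplexGysinHodgeType
import Literature.AlgebraicGeometry.Motives.HyperbolicWeilTypeProduct
import Literature.NumberTheory.Transcendental.DeRhamTheoremMultiplicative
import Mathlib.Tactic.Module
import HarnessLib

/-!
# The CM square `E₀ × E₀` with `(ψ₀, -ψ₀)` is a Weil-type abelian surface (the partner surface of the product trick)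

Family `hodge`, layer `Literature/AlgebraicGeometry/HodgeTheory`. Sibling proof file of
`WeilClassesDescending` / `WeilClassesDescendingProofs` (the named fact
`exists_weilTypeSurface_prod_isHyperbolicWeilType_all`: for a Weil-type `2n`-fold `(A₁, φ₁)` there
is a Weil SURFACE `(A₂, φ₂)` with `A₁ × A₂` of hyperbolic Weil type; Markman, arXiv:2509.23403
§11.5 Step 2; van Geemen, LNM 1594, Lemma 5.2, 5.3; Schoen, Compositio 114 (1998) §10). In print the
partner surface is `E₀ × E₀` for an elliptic curve `E₀` with complex multiplication by `√-d`, the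
field `K = ℚ(√-d)` acting through `(ι, ῑ)` — Schoen §10: "`A' = E × E` … where `K` acts on the
first factor through `ι` and on the second through `ῑ`"; van Geemen 5.3: the abelian varieties of
Weil type with multiplicities `(1, 1)`. This file PROVES, on the tree's real carriers and for EVERY
`d ≥ 1`, that this recipe yields a Weil-type surface in the exact typing of the fact's conclusion,
GIVEN the CM curve as data: for any complex abelian variety `E₀` of dimension `1` with an
endomorphism `ψ₀`, `ψ₀ ≫ ψ₀ = -d`, the square `B = E₀ × E₀` with `Φ = ψ₀ × (-ψ₀)` satisfies
`dim B = 2`, `Φ ≫ Φ = -d`, and carries classes `u₊ ∈ E₊(B, Φ)`, `u₋ ∈ E₋(B, Φ)`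
(`weilClassesPlus/Minus B Φ 1 d`), both non-zero, with `u₊ + u₋` RATIONAL of Hodge type `(1, 1)`
(`exists_weilType_cmSquare`).

## Proof (van Geemen, proof of Lemma 5.2; Schoen §10)

Let `T = ψ₀^*` on `H¹(E₀(ℂ); ℂ) ≅ ℂ²` (`T² = -d`), `v ≠ 0` a rational class, `s = i√d`. Then
`v, Tv` is a rational basis of `H¹` (`T` has no rational eigenvalue), `w_± = Tv ± s·v` are the
eigenvectors of `T` (`T w_± = ± s w_±`), `w₋ = conj w₊`, and each eigenspace is a LINE
(`two_mul_finrank_eigenspace_eq`). The one Hodge-theoretic input is the PURITY of `w₊`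
(`isOfHodgeType_one_or_of_eigenvector`): an eigenvector of `g^*` (`g` an endomorphism of a smooth
projective `X`) spanning its eigenline in `H¹` is of type `(1,0)` or `(0,1)` — its `(1,0)`- and
`(0,1)`-components (Hodge decomposition of a Hodge model, `HodgeModel.exists_sum_eq_of_hodgeDecomposition`)
are again eigenvectors, since `g^*` preserves Hodge types (`IsOfHodgeType.map_of_isSmoothProjective`,
Voisin I §7.3.2) and a class of two different types is zero (Voisin I Cor. 6.14); so they are
multiples of `w₊`. Hence `w₋ = conj w₊` has the conjugate type (`IsOfHodgeType.conjClass`). On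
`B = E₀ × E₀` with `Φ = ψ₀ × (-ψ₀)` put `u₊ = pr₁^* w₊ ∪ pr₂^* w₋`, `u₋ = pr₁^* w₋ ∪ pr₂^* w₊`:

* `Φ^*` acts on `pr₁^* w₊` and on `pr₂^* w₋` by `+s` (the SIGN FLIP on the second factor), so `u₊`
  is a joint eigenclass of the test endomorphisms `(x·𝟙 + y·Φ)^*` with character `(x + ys)²`, i.e.
  `u₊ ∈ E₊(B)`; likewise `u₋ ∈ E₋(B)` (`cupProduct_map_map_mem_pullbackEigenclasses`, Schoen's
  basis computation);
* `u₊ + u₋ = 2·pr₁^*Tv ∪ pr₂^*Tv + 2d·pr₁^*v ∪ pr₂^*v` is RATIONAL (`s² = -d`);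
* `u₊`, `u₋` are of type `(1,0) + (0,1) = (1,1)` (Künneth for Hodge types,
  `isOfHodgeType_cupProduct_map_fst_map_snd_of_multiplicative_deRham`, fed with de Rham's theorem
  `exists_deRhamIsoFamily_holds`) — whatever the type of `w₊` is: this is WHY the sign is flipped;
* `u₊ + u₋ ≠ 0`: its pull-back along the graph `Γ = (𝟙, ψ₀) : E₀ → E₀ × E₀` is `4d · v ∪ Tv`, and
  `v ∪ Tv ≠ 0` because `v, Tv` is a basis of `H¹` and `H²(E₀(ℂ)) ≠ 0` is spanned by cup products
  of degree-one classes (`HasExteriorCohomologyH1`); then both `u_±` are non-zero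
  (`ne_zero_of_isRationalClass_add`).

What is NOT here: the existence of `(E₀, ψ₀)` (a CM elliptic curve with `[√-d]` as a morphism of
abelian varieties over `ℂ`), and the aiming of `A₁ × B` (Hodge–Riemann in degree one, weighted
Segre classes) — the remaining inputs of `exists_weilTypeSurface_prod_isHyperbolicWeilType_all`.
Everything below is proved; no definition and no named fact is introduced (D-0026).

## References

* [Schoen1998HodgeWeilAddendum] C. Schoen, Addendum to: Hodge classes on self-products of a variety
  with an automorphism, Compositio Math. 114 (1998), §10 (`A' = E × E`, `K` acting by `(ι, ῑ)`).
* [vanGeemen1994HodgeAV] B. van Geemen, An introduction to the Hodge conjecture for abelian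
  varieties, LNM 1594 (1994), 4.9, Lemma 5.2 (proof: `W'₊`, `W'₋`), 5.3.
* [Markman2025SurveySecant] E. Markman, arXiv:2509.23403, §11.5 Step 2.
* [VoisinHodgeI2002] C. Voisin, Hodge Theory and Complex Algebraic Geometry I (2002), Cor. 6.12,
  Cor. 6.14, §7.3.2, Thm. 11.38.
-/

noncomputable section

open CategoryTheory

namespace Literature.AlgebraicGeometry.HodgeTheory

open Literature.AlgebraicTopology.SingularHomology
open Literature.AlgebraicGeometry.Motives

/-! ### Purity of eigenvectors in `H¹` -/

section Purity

variable {n : ℕ} {X : Motives.SchemeOver ℂ}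

/-- **`H¹ = H^{1,0} + H^{0,1}` on the carriers**: every class of `H¹(X(ℂ); ℂ)` of a smooth
projective `X` is the sum of a class of type `(1,0)` and a class of type `(0,1)` (the Hodge
decomposition of a Hodge model, `HodgeModel.exists_sum_eq_of_hodgeDecomposition`, in degree `1`).
[cite: VoisinHodgeI2002, §6.1.3 and §7.1.1] -/
theorem exists_add_eq_of_isOfHodgeType_one (hX : Motives.IsSmoothProjective n X)
    (c : complexBetti X 1) :
    ∃ a b : complexBetti X 1, a + b = c ∧ IsOfHodgeType n X 1 1 0 a ∧ IsOfHodgeType n X 1 0 1 b := by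
  classical
  obtain ⟨A⟩ := nonempty_hodgeModel_holds hX
  obtain ⟨z, hz, hzt⟩ := A.exists_sum_eq_of_hodgeDecomposition 1 c
  have h1 : Finset.HasAntidiagonal.antidiagonal 1 = {(0, 1), (1, 0)} := by decide
  rw [h1, Finset.sum_pair (by decide)] at hz
  refine ⟨z (1, 0), z (0, 1), by rw [add_comm]; exact hz, ⟨A, hzt (1, 0) (by simp)⟩,
    ⟨A, hzt (0, 1) (by simp)⟩⟩

/-- **A class of type `(1,0)` AND of type `(0,1)` is zero** ("a class of two different types is
zero": the pieces of the Hodge decomposition of a Hodge model are independent, field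
`HodgeModel.isInternal_hodgePQ`; all models give the same pieces,
`hodgePQ_independent_of_hodgeModel_holds`). [cite: VoisinHodgeI2002, Cor. 6.14] -/
theorem eq_zero_of_isOfHodgeType_one_zero_of_zero_one (hX : Motives.IsSmoothProjective n X)
    {a : complexBetti X 1} (h10 : IsOfHodgeType n X 1 1 0 a) (h01 : IsOfHodgeType n X 1 0 1 a) :
    a = 0 := by
  obtain ⟨A, hA⟩ := h10
  have hA' : A.pullback 1 a ∈ A.hodgePQ 1 0 1 := h01.mem_hodgePQ hX A
  set T : ↥(Finset.HasAntidiagonal.antidiagonal 1) →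
      Submodule ℂ (Literature.NumberTheory.Transcendental.complexDeRhamCohomology A.model A.carrier 1) :=
    fun i ↦ Literature.NumberTheory.Transcendental.hodgePQ A.model A.carrier 1 i.1.1 i.1.2 with hT
  have hind : iSupIndep T := (A.isInternal_hodgePQ 1).submodule_iSupIndep
  let i₁ : ↥(Finset.HasAntidiagonal.antidiagonal 1) := ⟨(1, 0), Finset.HasAntidiagonal.mem_antidiagonal.2 rfl⟩
  let i₀ : ↥(Finset.HasAntidiagonal.antidiagonal 1) := ⟨(0, 1), Finset.HasAntidiagonal.mem_antidiagonal.2 rfl⟩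
  have hne : i₁ ≠ i₀ := fun h ↦ by
    have h' : (1 : ℕ) = 0 := congrArg (fun i : ↥(Finset.HasAntidiagonal.antidiagonal 1) ↦ i.1.1) h
    exact one_ne_zero h'
  have hdisj : Disjoint (T i₁) (T i₀) := hind.pairwiseDisjoint hne
  obtain ⟨w, hw, hwc⟩ := Submodule.mem_map.1 hA
  obtain ⟨w', hw', hwc'⟩ := Submodule.mem_map.1 hA'
  have hww : w = w' := (A.deRham A.carrier 1).injective (hwc.trans hwc'.symm)
  have hw₁ : w ∈ T i₁ := hw
  have hw₀ : w ∈ T i₀ := hww ▸ hw'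
  have hw0 : w = 0 := (Submodule.disjoint_def.1 hdisj) w hw₁ hw₀
  apply A.pullback_injective 1
  rw [map_zero, ← hwc, hw0, map_zero]

/-- **Purity of eigenvectors**: for `X` smooth projective, `g : X ⟶ X`, and an eigenvector
`c ∈ H¹(X(ℂ); ℂ)` of `g^*` which SPANS its eigenspace (`g^* c' = μ c' ⇒ c' ∈ ℂ c`), `c` is of
Hodge type `(1,0)` or of Hodge type `(0,1)`: its two pure-type components are eigenvectors for the
same eigenvalue (`g^*` preserves types, Voisin I §7.3.2; a class of two types is zero, Cor. 6.14),
hence multiples of `c`. This is the step "`H^{1,0} = W^{1,0}_+ ⊕ W^{1,0}_-`" of van Geemen's proof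
of Lemma 5.2 for a curve. [cite: VoisinHodgeI2002, §7.3.2 and Cor. 6.14]
[cite: vanGeemen1994HodgeAV, proof of Lemma 5.2] -/
theorem isOfHodgeType_one_or_of_eigenvector (hX : Motives.IsSmoothProjective n X) (g : X ⟶ X)
    (μ : ℂ) {c : complexBetti X 1} (hc : complexBetti.map g 1 c = μ • c)
    (hline : ∀ c' : complexBetti X 1, complexBetti.map g 1 c' = μ • c' → ∃ t : ℂ, c' = t • c) :
    IsOfHodgeType n X 1 1 0 c ∨ IsOfHodgeType n X 1 0 1 c := by
  obtain ⟨a, b, hab, ha, hb⟩ := exists_add_eq_of_isOfHodgeType_one hX c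
  set G := (complexBetti.map g 1).hom with hG
  have hGc : G c = μ • c := hc
  have hga : IsOfHodgeType n X 1 1 0 (G a) := ha.map_of_isSmoothProjective hX hX g
  have hgb : IsOfHodgeType n X 1 0 1 (G b) := hb.map_of_isSmoothProjective hX hX g
  -- `(g^*a - μa) + (g^*b - μb) = g^*c - μc = 0`
  have hsum : (G a - μ • a) + (G b - μ • b) = 0 := by
    have h1 : G a + G b = μ • a + μ • b := by rw [← map_add, ← smul_add, hab, hGc]
    calc (G a - μ • a) + (G b - μ • b) = (G a + G b) - (μ • a + μ • b) := by abel
      _ = 0 := by rw [h1, sub_self]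
  have h1 : IsOfHodgeType n X 1 1 0 (G a - μ • a) := hga.sub hX (ha.smul μ)
  have h2 : IsOfHodgeType n X 1 0 1 (G b - μ • b) := hgb.sub hX (hb.smul μ)
  have heq : G a - μ • a = -(G b - μ • b) := eq_neg_of_add_eq_zero_left hsum
  have h1' : IsOfHodgeType n X 1 0 1 (G a - μ • a) := by rw [heq]; exact h2.neg
  have hza : G a - μ • a = 0 := eq_zero_of_isOfHodgeType_one_zero_of_zero_one hX h1 h1'
  have hzb : G b - μ • b = 0 := by rw [hza, zero_add] at hsum; exact hsum
  obtain ⟨s, hs⟩ := hline a (sub_eq_zero.1 hza)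
  obtain ⟨t, ht⟩ := hline b (sub_eq_zero.1 hzb)
  by_cases hs0 : s = 0
  · right
    have e : c = b := by rw [← hab, hs, hs0, zero_smul, zero_add]
    rw [e]
    exact hb
  · left
    have e : c = s⁻¹ • a := by rw [hs, smul_smul, inv_mul_cancel₀ hs0, one_smul]
    rw [e]
    exact ha.smul _

end Purity

/-! ### The curve: `H¹(E₀(ℂ); ℂ) = ℂ v ⊕ ℂ Tv` for a rational `v ≠ 0` -/

section Curve

variable {E₀ : Motives.AbelianVariety ℂ} {d : ℕ} {ψ₀ : E₀ ⟶ E₀}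

/-- `b₁(E₀) = 2` for `dim E₀ = 1`. [cite: LangeBirkenhake1992, §1.1 Prop. 1.1.9 (p. 20)] -/
theorem finrank_complexBetti_one_of_dim_eq_one (hE : E₀.dim = 1) :
    Module.finrank ℂ (complexBetti E₀.X 1) = 2 := by
  rw [surface_finrank_complexBetti_one, hE]

/-- There is a NON-ZERO RATIONAL class in `H¹(E₀(ℂ); ℂ)` when `dim E₀ = 1` (rational classes span,
`span_isRationalClass_eq_top_of_isSmoothProjective_holds`, and `b₁ = 2`). [cite: VoisinHodgeI2002, §7.1.1] -/
theorem exists_isRationalClass_ne_zero_one (hE : E₀.dim = 1) :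
    ∃ v : complexBetti E₀.X 1, IsRationalClass v ∧ v ≠ 0 := by
  by_contra h
  push Not at h
  have hX : Motives.IsSmoothProjective 1 E₀.X := isSmoothProjective_of_dim_eq' hE
  have htop := span_isRationalClass_eq_top_of_isSmoothProjective_holds 1 E₀.X hX 1
  have hbot : Submodule.span ℂ {c : complexBetti E₀.X 1 | IsRationalClass c} = ⊥ := by
    rw [Submodule.span_eq_bot]
    exact fun c hc ↦ h c hc
  have h0 : Module.finrank ℂ (complexBetti E₀.X 1) = 0 := by
    rw [← finrank_top, ← htop, hbot, finrank_bot]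
  rw [finrank_complexBetti_one_of_dim_eq_one hE] at h0
  exact two_ne_zero h0

/-- **`v, ψ₀^* v` are `ℂ`-independent** for a rational `v ≠ 0` and `ψ₀ ≫ ψ₀ = -d`, `d ≥ 1`: a
relation would be rational (`linearIndependent_iff_of_isRationalClass`: rational classes have no new
complex relations, Hatcher §3.1), `q₀ v + q₁ Tv = 0`; applying `T = ψ₀^*` (`T² = -d`) gives
`(q₀² + d q₁²) v = 0`, so `q₀ = q₁ = 0` ("`T` has no rational eigenvalue").
[cite: vanGeemen1994HodgeAV, 4.9] [cite: HatcherAT2002, §3.1] -/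
theorem linearIndependent_pair_map_one (hd : 0 < d) (hψ : ψ₀ ≫ ψ₀ = -(d • 𝟙 E₀))
    {v : complexBetti E₀.X 1} (hv : IsRationalClass v) (hv0 : v ≠ 0) :
    LinearIndependent ℂ ![v, complexBetti.map ψ₀.hom.hom.hom 1 v] := by
  set T := (complexBetti.map ψ₀.hom.hom.hom 1).hom with hTdef
  have hTv : IsRationalClass (T v) := hv.map _
  have hT2 : T (T v) = -((d : ℂ) • v) := complexBetti_map_map_one_of_comp_self hψ v
  have hrat : ∀ j, IsRationalClass ((![v, T v] : Fin 2 → complexBetti E₀.X 1) j) := by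
    intro j
    fin_cases j
    · exact hv
    · exact hTv
  change LinearIndependent ℂ ![v, T v]
  rw [linearIndependent_iff_of_isRationalClass hrat]
  intro q hq
  rw [Fin.sum_univ_two] at hq
  simp only [Matrix.cons_val_zero, Matrix.cons_val_one] at hq
  -- `hq : q₀ • v + q₁ • Tv = 0`; apply `T`
  have hq' : ((q 0 : ℚ) : ℂ) • T v + ((q 1 : ℚ) : ℂ) • (-((d : ℂ) • v)) = 0 := by
    have h := congrArg T hq
    rw [map_add, map_smul, map_smul, hT2, map_zero] at h
    exact h
  have key : (((q 0 : ℚ) : ℂ) ^ 2 + (d : ℂ) * ((q 1 : ℚ) : ℂ) ^ 2) • v = 0 := by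
    calc (((q 0 : ℚ) : ℂ) ^ 2 + (d : ℂ) * ((q 1 : ℚ) : ℂ) ^ 2) • v
        = ((q 0 : ℚ) : ℂ) • (((q 0 : ℚ) : ℂ) • v + ((q 1 : ℚ) : ℂ) • T v) -
            ((q 1 : ℚ) : ℂ) • (((q 0 : ℚ) : ℂ) • T v + ((q 1 : ℚ) : ℂ) • (-((d : ℂ) • v))) := by
          module
      _ = 0 := by rw [hq, hq', smul_zero, smul_zero, sub_zero]
  have hcoef : ((q 0 : ℚ) : ℂ) ^ 2 + (d : ℂ) * ((q 1 : ℚ) : ℂ) ^ 2 = 0 := by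
    rcases smul_eq_zero.1 key with h | h
    · exact h
    · exact absurd h hv0
  have hq2 : (q 0) ^ 2 + (d : ℚ) * (q 1) ^ 2 = 0 := by exact_mod_cast hcoef
  have hd' : (0 : ℚ) < d := by exact_mod_cast hd
  have h0sq : (q 0) ^ 2 = 0 := by nlinarith [sq_nonneg (q 0), sq_nonneg (q 1), mul_nonneg hd'.le (sq_nonneg (q 1))]
  have h1sq : (q 1) ^ 2 = 0 := by nlinarith [sq_nonneg (q 0), sq_nonneg (q 1), mul_nonneg hd'.le (sq_nonneg (q 1))]
  have h0 : q 0 = 0 := pow_eq_zero_iff (n := 2) two_ne_zero |>.1 h0sq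
  have h1 : q 1 = 0 := pow_eq_zero_iff (n := 2) two_ne_zero |>.1 h1sq
  funext j
  fin_cases j
  · exact h0
  · exact h1

/-- `v ∪ Tv ≠ 0` in `H²(E₀(ℂ); ℂ)`: `v, Tv` is a basis of `H¹` (`b₁ = 2`), `H² ≠ 0`
(`b₂ = C(2,2) = 1`) is spanned by products of degree-one classes (`H•(E₀(ℂ)) = ⋀• H¹`,
`HasExteriorCohomologyH1`), and `a ∪ b = (a₀b₁ - a₁b₀)·(v ∪ Tv)` for `a, b ∈ H¹` (alternation).
[cite: LangeBirkenhake1992, Lemma 1.1.17 (b)] -/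
theorem cupProduct_map_one_ne_zero (hE : E₀.dim = 1) (hd : 0 < d) (hψ : ψ₀ ≫ ψ₀ = -(d • 𝟙 E₀))
    {v : complexBetti E₀.X 1} (hv : IsRationalClass v) (hv0 : v ≠ 0) :
    cupProduct (rfl : 1 + 1 = 2) v (complexBetti.map ψ₀.hom.hom.hom 1 v) ≠ 0 := by
  classical
  set Tv := complexBetti.map ψ₀.hom.hom.hom 1 v with hTv
  intro h0
  have hli := linearIndependent_pair_map_one hd hψ hv hv0
  haveI : Module.Finite ℂ (complexBetti E₀.X 1) := finite_complexBetti_abelianVariety E₀ 1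
  haveI : Module.Finite ℂ (complexBetti E₀.X 2) := finite_complexBetti_abelianVariety E₀ 2
  have hcard : Fintype.card (Fin 2) = Module.finrank ℂ (complexBetti E₀.X 1) := by
    rw [Fintype.card_fin, finrank_complexBetti_one_of_dim_eq_one hE]
  let bE := basisOfLinearIndependentOfCardEqFinrank hli hcard
  have hbE : ∀ j, bE j = ![v, Tv] j := fun j ↦ by
    rw [coe_basisOfLinearIndependentOfCardEqFinrank]
  -- every product of two degree-one classes is a multiple of `v ∪ Tv = 0`
  set P := cupProduct (X := Motives.ComplexPoints E₀.X) (R := ℂ) (rfl : 1 + 1 = 2) with hP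
  have hvv : P v v = 0 := cup_self_deg_one v
  have htt : P Tv Tv = 0 := cup_self_deg_one Tv
  have htv : P Tv v = -P v Tv := by
    have h := cupProduct_gradedComm_holds ℂ (Motives.ComplexPoints E₀.X) (rfl : 1 + 1 = 2) rfl Tv v
    simpa using h
  have hprod : ∀ a b : complexBetti E₀.X 1, P a b = 0 := by
    intro a b
    have ha := bE.sum_repr a
    have hb := bE.sum_repr b
    rw [Fin.sum_univ_two, hbE, hbE] at ha hb
    simp only [Matrix.cons_val_zero, Matrix.cons_val_one] at ha hb
    rw [← ha, ← hb]
    simp only [map_add, map_smul, LinearMap.add_apply, LinearMap.smul_apply, hvv, htt, htv, h0,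
      smul_zero, neg_zero, add_zero]
  -- but `H²(E₀(ℂ)) ≠ 0` is spanned by such products
  have hΛ := surface_hasExteriorCohomologyH1 E₀
  have hspan := hΛ.span_range_cupPowOne 2
  have hzero : ∀ u : Fin 2 → complexBetti E₀.X 1, cupPowOne ℂ (Motives.ComplexPoints E₀.X) 2 u = 0 := by
    intro u
    rw [cupPowOne_succ, Fin.tail_def]
    simp only [cupPowOne_one]
    exact hprod (u 0) (u 1)
  have hbot : Submodule.span ℂ (Set.range (cupPowOne ℂ (Motives.ComplexPoints E₀.X) 2)) = ⊥ := by
    rw [Submodule.span_eq_bot]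
    rintro x ⟨u, rfl⟩
    exact hzero u
  have hfin : Module.finrank ℂ (complexBetti E₀.X 2) = 1 := by
    have h := hΛ.finrank_eq 2
    rw [finrank_complexBetti_one_of_dim_eq_one hE] at h
    simpa using h
  have h0' : Module.finrank ℂ (complexBetti E₀.X 2) = 0 := by
    rw [← finrank_top, ← hspan, hbot, finrank_bot]
  omega

end Curve

/-! ### The square `B = E₀ × E₀` with `Φ = ψ₀ × (-ψ₀)` -/

section CMSquare

variable {E₀ : Motives.AbelianVariety ℂ} {d : ℕ} {ψ₀ : E₀ ⟶ E₀}

/-- `Φ ≫ Φ = -d` for `Φ = ψ₀ × (-ψ₀)` on `E₀ × E₀` (`(-ψ₀) ≫ (-ψ₀) = ψ₀ ≫ ψ₀ = -d`;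
`prodLift_comp_self_eq_neg_nsmul`). [cite: Schoen1998HodgeWeilAddendum, §10] -/
theorem cmSquare_comp_self (hψ : ψ₀ ≫ ψ₀ = -(d • 𝟙 E₀)) :
    AbelianVariety.prodLift (AbelianVariety.fst E₀ E₀ ≫ ψ₀) (AbelianVariety.snd E₀ E₀ ≫ (-ψ₀)) ≫
        AbelianVariety.prodLift (AbelianVariety.fst E₀ E₀ ≫ ψ₀) (AbelianVariety.snd E₀ E₀ ≫ (-ψ₀)) =
      -(d • 𝟙 (E₀.prod E₀)) :=
  prodLift_comp_self_eq_neg_nsmul hψ (by rw [Preadditive.neg_comp_neg, hψ])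

/-- `dim (E₀ × E₀) = 2` for `dim E₀ = 1`. [cite: Schoen1998HodgeWeilAddendum, §10] -/
theorem dim_cmSquare (hE : E₀.dim = 1) : (E₀.prod E₀).dim = 2 * 1 := by
  rw [AbelianVariety.dim_prod, hE]

/-- **The CM square is a Weil-type abelian surface, with its pair of Weil classes** (Schoen 1998
§10; van Geemen 1994, 5.3 and proof of Lemma 5.2). For a complex abelian variety `E₀` of dimension
`1` with `ψ₀ ≫ ψ₀ = -(d • 𝟙)`, `d ≥ 1`, the surface `B = E₀ × E₀` with `Φ = ψ₀ × (-ψ₀)` has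
`dim B = 2`, is smooth projective, `Φ ≫ Φ = -(d • 𝟙)`, and there are `u₊ ∈ weilClassesPlus B Φ 1 d`,
`u₋ ∈ weilClassesMinus B Φ 1 d` with `u₊ + u₋` rational of Hodge type `(1,1)` and `u₊ ≠ 0`,
`u₋ ≠ 0` — the surface conjuncts of the conclusion of
`exists_weilTypeSurface_prod_isHyperbolicWeilType_all` for the partner `A₂ = E₀ × E₀`,
`φ₂ = ψ₀ × (-ψ₀)`. Proof: module docstring. [cite: Schoen1998HodgeWeilAddendum, §10]
[cite: vanGeemen1994HodgeAV, proof of Lemma 5.2 and 5.3] -/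
theorem exists_weilType_cmSquare (hE : E₀.dim = 1) (hd : 0 < d) (hψ : ψ₀ ≫ ψ₀ = -(d • 𝟙 E₀)) :
    (E₀.prod E₀).dim = 2 * 1 ∧ Motives.IsSmoothProjective (2 * 1) (E₀.prod E₀).X ∧
      AbelianVariety.prodLift (AbelianVariety.fst E₀ E₀ ≫ ψ₀) (AbelianVariety.snd E₀ E₀ ≫ (-ψ₀)) ≫
          AbelianVariety.prodLift (AbelianVariety.fst E₀ E₀ ≫ ψ₀) (AbelianVariety.snd E₀ E₀ ≫ (-ψ₀)) =
        -(d • 𝟙 (E₀.prod E₀)) ∧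
      ∃ up um : complexBetti (E₀.prod E₀).X (2 * 1),
        up ∈ weilClassesPlus (E₀.prod E₀)
          (AbelianVariety.prodLift (AbelianVariety.fst E₀ E₀ ≫ ψ₀) (AbelianVariety.snd E₀ E₀ ≫ (-ψ₀))) 1 d ∧
        um ∈ weilClassesMinus (E₀.prod E₀)
          (AbelianVariety.prodLift (AbelianVariety.fst E₀ E₀ ≫ ψ₀) (AbelianVariety.snd E₀ E₀ ≫ (-ψ₀))) 1 d ∧
        IsRationalClass (up + um) ∧ IsOfHodgeType (2 * 1) (E₀.prod E₀).X (2 * 1) 1 1 (up + um) ∧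
        up ≠ 0 ∧ um ≠ 0 := by
  classical
  refine ⟨dim_cmSquare hE, isSmoothProjective_of_dim_eq' (dim_cmSquare hE), cmSquare_comp_self hψ, ?_⟩
  -- notation
  set B := E₀.prod E₀ with hB
  set Φ : B ⟶ B := AbelianVariety.prodLift (AbelianVariety.fst E₀ E₀ ≫ ψ₀)
    (AbelianVariety.snd E₀ E₀ ≫ (-ψ₀)) with hΦ
  have hX : Motives.IsSmoothProjective 1 E₀.X := isSmoothProjective_of_dim_eq' hE
  have hB2 : Motives.IsSmoothProjective 2 B.X := isSmoothProjective_of_dim_eq' (dim_cmSquare hE)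
  have hΦΦ : Φ ≫ Φ = -(d • 𝟙 B) := cmSquare_comp_self hψ
  set T := (complexBetti.map ψ₀.hom.hom.hom 1).hom with hTdef
  have hT2 : ∀ c, T (T c) = -((d : ℂ) • c) := fun c ↦ complexBetti_map_map_one_of_comp_self hψ c
  set s : ℂ := Complex.I * (Real.sqrt d : ℂ) with hs
  have hs2 : s * s = -(d : ℂ) := by rw [← sq, hs, I_mul_sqrt_sq]
  have hs0 : s ≠ 0 := I_mul_sqrt_ne_zero hd
  -- the rational basis `v, Tv` and the eigenvectors `w± = Tv ± s v`
  obtain ⟨v, hv, hv0⟩ := exists_isRationalClass_ne_zero_one hE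
  have hTv : IsRationalClass (T v) := hv.map _
  have hli : LinearIndependent ℂ ![v, T v] := linearIndependent_pair_map_one hd hψ hv hv0
  set wp : complexBetti E₀.X 1 := T v + s • v with hwp
  set wm : complexBetti E₀.X 1 := T v - s • v with hwm
  have hTwp : T wp = s • wp := by
    rw [hwp, map_add, map_smul, hT2, smul_add, smul_smul, hs2, neg_smul, add_comm]
  have hTwm : T wm = (-s) • wm := by
    rw [hwm, map_sub, map_smul, hT2, smul_sub, smul_smul, neg_mul, hs2, neg_neg, neg_smul]
    abel
  have hwp0 : wp ≠ 0 := by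
    intro h
    have h' : s • v + (1 : ℂ) • T v = 0 := by rw [one_smul, add_comm]; exact h
    exact hs0 (LinearIndependent.pair_iff.1 hli s 1 h').1
  -- conjugation: `conj wp = wm`
  have hconj : conjClass (Motives.ComplexPoints E₀.X) 1 wp = wm := by
    rw [hwp, hwm, conjClass_add, conjClass_smul, hTv.conjClass_eq, hv.conjClass_eq, hs]
    simp only [map_mul, Complex.conj_I, Complex.conj_ofReal]
    rw [neg_mul, neg_smul, sub_eq_add_neg]
  -- the `+s`-eigenspace of `T` is a line, spanned by `wp`
  have hline : ∀ c' : complexBetti E₀.X 1, complexBetti.map ψ₀.hom.hom.hom 1 c' = s • c' →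
      ∃ t : ℂ, c' = t • wp := by
    intro c' hc'
    haveI : Module.Finite ℂ (complexBetti E₀.X 1) := finite_complexBetti_abelianVariety E₀ 1
    have hdim : Module.finrank ℂ (Module.End.eigenspace T s) = 1 := by
      have h := two_mul_finrank_eigenspace_eq hd hψ
      rw [finrank_complexBetti_one_of_dim_eq_one hE] at h
      change 2 * Module.finrank ℂ (Module.End.eigenspace T s) = 2 at h
      omega
    have hwpmem : wp ∈ Module.End.eigenspace T s := Module.End.mem_eigenspace_iff.2 hTwp
    have hc'mem : c' ∈ Module.End.eigenspace T s := Module.End.mem_eigenspace_iff.2 hc'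
    have hne : (⟨wp, hwpmem⟩ : Module.End.eigenspace T s) ≠ 0 := fun h ↦
      hwp0 (congrArg Subtype.val h)
    obtain ⟨t, ht⟩ := (finrank_eq_one_iff_of_nonzero' _ hne).1 hdim ⟨c', hc'mem⟩
    exact ⟨t, (congrArg Subtype.val ht).symm⟩
  -- purity of `wp`, and the conjugate type for `wm`
  have hpure : IsOfHodgeType 1 E₀.X 1 1 0 wp ∨ IsOfHodgeType 1 E₀.X 1 0 1 wp :=
    isOfHodgeType_one_or_of_eigenvector hX ψ₀.hom.hom.hom s hTwp hline
  obtain ⟨p, q, hpq, hwpt, hwmt⟩ : ∃ p q : ℕ, p + q = 1 ∧ IsOfHodgeType 1 E₀.X 1 p q wp ∧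
      IsOfHodgeType 1 E₀.X 1 q p wm := by
    rcases hpure with h | h
    · exact ⟨1, 0, rfl, h, hconj ▸ h.conjClass hX⟩
    · exact ⟨0, 1, rfl, h, hconj ▸ h.conjClass hX⟩
  -- the classes on `B`
  set Xf := (complexBetti.map (AbelianVariety.fst E₀ E₀).hom.hom.hom 1).hom with hXf
  set Yf := (complexBetti.map (AbelianVariety.snd E₀ E₀).hom.hom.hom 1).hom with hYf
  set P := cupProduct (X := Motives.ComplexPoints B.X) (R := ℂ) (rfl : 1 + 1 = 2) with hP
  set up : complexBetti B.X 2 := P (Xf wp) (Yf wm) with hup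
  set um : complexBetti B.X 2 := P (Xf wm) (Yf wp) with hum
  -- (1) the Weil typing
  have hp₁ : AbelianVariety.fst E₀ E₀ ≫ ψ₀ = Φ ≫ AbelianVariety.fst E₀ E₀ :=
    (AbelianVariety.prodLift_fst _ _).symm
  have hp₂ : AbelianVariety.snd E₀ E₀ ≫ (-ψ₀) = Φ ≫ AbelianVariety.snd E₀ E₀ :=
    (AbelianVariety.prodLift_snd _ _).symm
  have hnegT : ∀ c, complexBetti.map (-ψ₀).hom.hom.hom 1 c = -(T c) := fun c ↦ by
    rw [complexBetti_map_neg_one]; rfl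
  have hwp_plus : wp ∈ pullbackEigenclasses E₀ ψ₀ 1
      (fun x y ↦ (x : ℂ) + (y : ℂ) * Complex.I * (Real.sqrt d : ℂ)) := by
    rw [pullbackEigenclasses_one_eq_eigenspace]
    exact Module.End.mem_eigenspace_iff.2 hTwp
  have hwm_minus : wm ∈ pullbackEigenclasses E₀ ψ₀ 1
      (fun x y ↦ (x : ℂ) - (y : ℂ) * Complex.I * (Real.sqrt d : ℂ)) := by
    rw [pullbackEigenclasses_one_eq_eigenspace_neg]
    exact Module.End.mem_eigenspace_iff.2 hTwm
  have hwm_plus' : wm ∈ pullbackEigenclasses E₀ (-ψ₀) 1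
      (fun x y ↦ (x : ℂ) + (y : ℂ) * Complex.I * (Real.sqrt d : ℂ)) := by
    rw [pullbackEigenclasses_one_eq_eigenspace, Module.End.mem_eigenspace_iff]
    change complexBetti.map (-ψ₀).hom.hom.hom 1 wm = s • wm
    rw [hnegT, hTwm, neg_smul, neg_neg]
  have hwp_minus' : wp ∈ pullbackEigenclasses E₀ (-ψ₀) 1
      (fun x y ↦ (x : ℂ) - (y : ℂ) * Complex.I * (Real.sqrt d : ℂ)) := by
    rw [pullbackEigenclasses_one_eq_eigenspace_neg, Module.End.mem_eigenspace_iff]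
    change complexBetti.map (-ψ₀).hom.hom.hom 1 wp = (-s) • wp
    rw [hnegT, hTwp, neg_smul]
  have hup_mem : up ∈ weilClassesPlus B Φ 1 d := by
    have h := cupProduct_map_map_mem_pullbackEigenclasses hp₁ hp₂ (rfl : 1 + 1 = 2) hwp_plus hwm_plus'
    rw [mem_weilClassesPlus_iff]
    intro x y
    have h' := (mem_pullbackEigenclasses_iff.1 h) x y
    rw [h']
    congr 1
    ring
  have hum_mem : um ∈ weilClassesMinus B Φ 1 d := by
    have h := cupProduct_map_map_mem_pullbackEigenclasses hp₁ hp₂ (rfl : 1 + 1 = 2) hwm_minus hwp_minus'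
    rw [mem_weilClassesMinus_iff]
    intro x y
    have h' := (mem_pullbackEigenclasses_iff.1 h) x y
    rw [h']
    congr 1
    ring
  -- (2) `up + um = 2·(XTv ∪ YTv) + 2d·(Xv ∪ Yv)` is rational
  have hsum : up + um = ((2 : ℚ) : ℂ) • P (Xf (T v)) (Yf (T v)) + ((2 * d : ℚ) : ℂ) • P (Xf v) (Yf v) := by
    rw [hup, hum, hwp, hwm]
    simp only [map_add, map_sub, map_smul, LinearMap.add_apply, LinearMap.sub_apply,
      LinearMap.smul_apply, smul_sub, smul_add, smul_smul, hs2]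
    push_cast
    module
  have hrat : IsRationalClass (up + um) := by
    rw [hsum]
    exact ((isRationalClass_cupProduct_map_fst_map_snd (rfl : 1 + 1 = 2) hTv hTv).smul 2).add
      ((isRationalClass_cupProduct_map_fst_map_snd (rfl : 1 + 1 = 2) hv hv).smul (2 * d))
  -- (3) Hodge type `(1,1)`
  have hdR : ∀ (E : Type) [NormedAddCommGroup E] [NormedSpace ℂ E] [FiniteDimensional ℂ E],
      Literature.NumberTheory.Transcendental.exists_deRhamIsoFamily (modelWithCornersSelf ℝ E) :=
    fun E _ _ _ ↦ Literature.NumberTheory.Transcendental.exists_deRhamIsoFamily_holds E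
  have hup_t : IsOfHodgeType 2 B.X 2 1 1 up := by
    have h := isOfHodgeType_cupProduct_map_fst_map_snd_of_multiplicative_deRham hdR E₀ E₀ 1 1 hE hE
      1 1 2 rfl p q q p wp wm hwpt hwmt
    have e1 : p + q = 1 := hpq
    have e2 : q + p = 1 := by omega
    rw [e1, e2] at h
    exact h
  have hum_t : IsOfHodgeType 2 B.X 2 1 1 um := by
    have h := isOfHodgeType_cupProduct_map_fst_map_snd_of_multiplicative_deRham hdR E₀ E₀ 1 1 hE hE
      1 1 2 rfl q p p q wm wp hwmt hwpt
    have e1 : q + p = 1 := by omega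
    have e2 : p + q = 1 := hpq
    rw [e1, e2] at h
    exact h
  have htype : IsOfHodgeType (2 * 1) B.X (2 * 1) 1 1 (up + um) := hup_t.add hB2 hum_t
  -- (4) non-vanishing: pull back along the graph `Γ = (𝟙, ψ₀)`
  have hne : up + um ≠ 0 := by
    intro h0
    set Γ : E₀ ⟶ B := AbelianVariety.prodLift (𝟙 E₀) ψ₀ with hΓ
    set G := (complexBetti.map Γ.hom.hom.hom 2).hom with hG
    set G1 := (complexBetti.map Γ.hom.hom.hom 1).hom with hG1
    set P' := cupProduct (X := Motives.ComplexPoints E₀.X) (R := ℂ) (rfl : 1 + 1 = 2) with hP'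
    have hGX : ∀ a, G1 (Xf a) = a := fun a ↦ by
      change singularCohomology.map ℂ ℂ _ 1 (singularCohomology.map ℂ ℂ _ 1 a) = a
      rw [abelianVarietyHom_map_map_apply, AbelianVariety.prodLift_fst]
      change complexBetti.map (𝟙 E₀.X) 1 a = a
      rw [complexBetti.map_id]
      rfl
    have hGY : ∀ a, G1 (Yf a) = T a := fun a ↦ by
      change singularCohomology.map ℂ ℂ _ 1 (singularCohomology.map ℂ ℂ _ 1 a) = _
      rw [abelianVarietyHom_map_map_apply, AbelianVariety.prodLift_snd]
    have hGP : ∀ a b, G (P a b) = P' (G1 a) (G1 b) := fun a b ↦ cupProduct_map _ rfl a b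
    have htv : P' (T v) v = -P' v (T v) := by
      have h := cupProduct_gradedComm_holds ℂ (Motives.ComplexPoints E₀.X) (rfl : 1 + 1 = 2) rfl (T v) v
      simpa using h
    have hG0 : G (up + um) = ((4 * d : ℚ) : ℂ) • P' v (T v) := by
      rw [hsum, map_add, map_smul, map_smul, hGP, hGP, hGX, hGX, hGY, hGY, hT2, map_neg, map_smul,
        htv]
      push_cast
      module
    have hvt : P' v (T v) ≠ 0 := cupProduct_map_one_ne_zero hE hd hψ hv hv0
    have h4 : ((4 * d : ℚ) : ℂ) ≠ 0 := by
      have : (4 * d : ℚ) ≠ 0 := mul_ne_zero four_ne_zero (by exact_mod_cast hd.ne')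
      exact_mod_cast this
    have : G (up + um) = 0 := by rw [h0, map_zero]
    rw [hG0] at this
    rcases smul_eq_zero.1 this with h | h
    · exact h4 h
    · exact hvt h
  obtain ⟨hup0, hum0⟩ := ne_zero_of_isRationalClass_add one_pos hd hup_mem hum_mem hrat hne
  exact ⟨up, um, hup_mem, hum_mem, hrat, htype, hup0, hum0⟩

/-- **The partner surface, packaged**: for every complex abelian variety `E₀` of dimension `1`
carrying `ψ₀` with `ψ₀ ≫ ψ₀ = -(d • 𝟙)`, `d ≥ 1`, there is a Weil-type abelian surface `(A₂, φ₂)`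
for `ℚ(√-d)` with its pair of Weil classes — namely `A₂ = E₀ × E₀`, `φ₂ = ψ₀ × (-ψ₀)` — in the
typing of `exists_weilTypeSurface_prod_isHyperbolicWeilType_all`. [cite: Schoen1998HodgeWeilAddendum, §10]
[cite: vanGeemen1994HodgeAV, 5.3] -/
theorem exists_weilTypeSurface_of_cmCurve (hE : E₀.dim = 1) (hd : 0 < d)
    (hψ : ψ₀ ≫ ψ₀ = -(d • 𝟙 E₀)) :
    ∃ (φ₂ : E₀.prod E₀ ⟶ E₀.prod E₀), (E₀.prod E₀).dim = 2 * 1 ∧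
      Motives.IsSmoothProjective (2 * 1) (E₀.prod E₀).X ∧ φ₂ ≫ φ₂ = -(d • 𝟙 (E₀.prod E₀)) ∧
      AbelianVariety.fst E₀ E₀ ≫ ψ₀ = φ₂ ≫ AbelianVariety.fst E₀ E₀ ∧
      AbelianVariety.snd E₀ E₀ ≫ (-ψ₀) = φ₂ ≫ AbelianVariety.snd E₀ E₀ ∧
      ∃ up um : complexBetti (E₀.prod E₀).X (2 * 1), up ∈ weilClassesPlus (E₀.prod E₀) φ₂ 1 d ∧
        um ∈ weilClassesMinus (E₀.prod E₀) φ₂ 1 d ∧ IsRationalClass (up + um) ∧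
        IsOfHodgeType (2 * 1) (E₀.prod E₀).X (2 * 1) 1 1 (up + um) ∧ up ≠ 0 ∧ um ≠ 0 := by
  obtain ⟨h1, h2, h3, h4⟩ := exists_weilType_cmSquare hE hd hψ
  exact ⟨_, h1, h2, h3, (AbelianVariety.prodLift_fst _ _).symm, (AbelianVariety.prodLift_snd _ _).symm, h4⟩

end CMSquare

end Literature.AlgebraicGeometry.HodgeTheory

end
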